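import Mathlib
import Literature.AlgebraicGeometry.Ramification.InertiaNormalSylow
import Literature.AlgebraicGeometry.Ramification.NormalSylowExtensions
import Literature.RingTheory.CompleteLocalRings.TameAutomorphismCotangent
import Summits.ResolutionOfSingularities.ResolutionOfSingularities.Theorems.WildQuotientsWildQuotientResolutionStubBorelCore
import Summits.ResolutionOfSingularities.ResolutionOfSingularities.Theorems.WildQuotientsWildQuotientResolutionUnipotentLevel
import HarnessLib

/-!
# Inertia stabilising a flag of the cotangent space with p-closed GRADED PIECES is p-closed (crux `WildQuotients.WildQuotientResolution`, Phase 0, any embedding dimension)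

Crux stmt-ResolutionOfSingularities-15640 (`WildQuotientResolution`), line `Sketch` (card
`p-closure-sylow-separation`), registered stub `stub_phaseZeroHighDim` (= PhaseZeroModel for
`dim X′ ≥ 3`). One equivariant blow-up of a `τ`-stable centre `J` makes the inertia UPSTAIRS
stabilise the flag `𝔪² ⊆ W̃ + 𝔪² ⊆ J + 𝔪² ⊆ 𝔪` of the cotangent space `V = 𝔪/𝔪²` downstairs and
act on the middle piece `J̄/W̄` through a character (`FlagCore.stub_flagCore`,
`Theorems/…StubFlagCore.lean`, is the case where ALL three pieces are lines: `dim J̄ ≤ 2`,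
`codim J̄ ≤ 1`, i.e. embedding dimension `3`). From embedding dimension `4` on (the first open
dimension of the summit, cf. `CyclicQuotientFourfolds` stmt-17941) the outer pieces `W̄` and
`V/J̄` are planes or bigger, and p-closedness upstairs must come from an INDUCTIVE hypothesis on
the action on those pieces. This file supplies exactly that group-theoretic end, with no
dimension bound and no line condition:

**Theorem** (`hasNormalSylow_of_flag_pieces`). Let `(R, 𝔪, κ)` be a Noetherian local ring of
residue characteristic `p`, `τ` a faithful residue-trivial action of the finite group `I`, and
`K 0 ≤ K 1 ≤ ⋯` ideals with `K 0 ≤ 𝔪²` and `𝔪 ≤ K n`. Suppose that for each `i < n` the action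
of `I` on the piece `K (i+1) / K i` factors through a FINITE p-CLOSED group `A i`
(`f i : I →* A i` whose kernel moves `K (i+1)` only inside `K i`). Then `I` has a normal Sylow
`p`-subgroup.

Proof. `U := ⋂ ker (f i) = ker F`, `F = (f i)_i : I →* Π_{i<n} A i`; the finite product of
p-closed groups is p-closed (`hasNormalSylow_pi`: the product of the normal Sylow subgroups
contains every `p`-subgroup, by uniqueness of the Sylow subgroup in each factor), so is the image
of `F` (`HasNormalSylow.subgroup`) and `I/U ≅ F.range`. An element of `U` lowers the flag one
step, hence is unipotent of level `n` on `V` (`UnipotentLevel.iterate_sub_mem_of_flag`), so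
`g ^ (p ^ n)` is cotangent-trivial (`UnipotentLevel.cotangentTrivial_pow_of_iterate_sub`) and `g`
has `p`-power order (`BorelCore.exists_pow_eq_one_of_cotangentTrivial`): `U` is a normal
`p`-subgroup with p-closed quotient, so `I` is p-closed
(`HasNormalSylow.of_isPGroup_of_quotient`, `NormalSylowExtensions.lean`). The assembly with a
general p-closed target, `hasNormalSylow_of_pClosed_quotient`, generalises
`FlagCore.hasNormalSylow_of_character` (target without `p`-torsion).

[OURS · crux stmt-ResolutionOfSingularities-15640 · helper toward `stub_phaseZeroHighDim`; folklore
group theory / local algebra, counted 0; AI-level work, weaker than expert review.]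

* `hasNormalSylow_pi` — a finite product of finite p-closed groups is p-closed.
* `hasNormalSylow_of_pClosed_quotient` — faithful residue-trivial `I`, `f : I →* A` with `A`
  finite p-closed and `ker f` acting unipotently on `𝔪/𝔪²` ⟹ `I` p-closed.
* `hasNormalSylow_of_flag_pieces` — the theorem.
-/

-- single-problem summit: the doubled namespace component `ResolutionOfSingularities` is forced
set_option linter.dupNamespace false

open IsLocalRing Literature.AlgebraicGeometry.Ramification Literature.RingTheory.CompleteLocalRings
open Summit.ResolutionOfSingularities.ResolutionOfSingularities.Theorems.WildQuotientResolution.BorelCore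
open Summit.ResolutionOfSingularities.ResolutionOfSingularities.Theorems.WildQuotientResolution.UnipotentLevel

namespace Summit.ResolutionOfSingularities.ResolutionOfSingularities.Theorems.WildQuotientResolution.FlagPieces

/-! ## Finite products of p-closed groups -/

/-- **A finite product of finite p-closed groups is p-closed**: if every `A i` has a normal Sylow
`p`-subgroup `P i`, then `Π i, P i` is a normal Sylow `p`-subgroup of `Π i, A i` — it is a normal
`p`-subgroup containing every `p`-subgroup `H` (the projection of `H` to `A i` is a `p`-subgroup,
hence inside the unique Sylow subgroup `P i`). The binary case is `HasNormalSylow.prod`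
(`NormalSylowExtensions.lean`). [folklore] -/
theorem hasNormalSylow_pi {p : ℕ} [Fact p.Prime] {ι : Type*} [Finite ι] {A : ι → Type*}
    [∀ i, Group (A i)] [∀ i, Finite (A i)] (h : ∀ i, HasNormalSylow p (A i)) :
    HasNormalSylow p (∀ i, A i) := by
  classical
  choose P hP using h
  let Q : Subgroup (∀ i, A i) := Subgroup.pi Set.univ fun i => (P i : Subgroup (A i))
  have hQmem : ∀ x, x ∈ Q ↔ ∀ i, x i ∈ (P i : Subgroup (A i)) := fun x => by
    simp only [Q, Subgroup.mem_pi, Set.mem_univ, forall_const]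
  -- `Q` is a `p`-group
  have hQp : IsPGroup p Q := by
    rintro ⟨x, hx⟩
    have hx' := (hQmem x).mp hx
    choose k hk using fun i => (P i).isPGroup' ⟨x i, hx' i⟩
    haveI := Fintype.ofFinite ι
    refine ⟨∑ j, k j, Subtype.ext ?_⟩
    rw [Subgroup.coe_pow, Subgroup.coe_one]
    funext i
    have hki : x i ^ p ^ k i = 1 := congrArg Subtype.val (hk i)
    have hle : k i ≤ ∑ j, k j := Finset.single_le_sum (fun j _ => Nat.zero_le (k j))
      (Finset.mem_univ i)
    rw [Pi.pow_apply, Pi.one_apply, ← Nat.add_sub_cancel' hle, pow_add, pow_mul, hki, one_pow]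
  -- `Q` contains every `p`-subgroup
  have hmax : ∀ H : Subgroup (∀ i, A i), IsPGroup p H → H ≤ Q := by
    intro H hH x hx
    rw [hQmem]
    intro i
    obtain ⟨S, hS⟩ := (hH.map (Pi.evalMonoidHom A i)).exists_le_sylow
    haveI : Subsingleton (Sylow p (A i)) := HasNormalSylow.subsingleton ⟨P i, hP i⟩
    have hSP : S = P i := Subsingleton.elim _ _
    rw [← hSP]
    exact hS (Subgroup.mem_map_of_mem (Pi.evalMonoidHom A i) hx)
  -- `Q` is normal
  have hQn : Q.Normal := ⟨fun x hx g => (hQmem _).mpr fun i => by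
    rw [Pi.mul_apply, Pi.mul_apply, Pi.inv_apply]
    exact (hP i).conj_mem (x i) ((hQmem x).mp hx i) (g i)⟩
  exact ⟨⟨Q, hQp, fun {H} hH hle => le_antisymm (hmax H hH) hle⟩, hQn⟩

section LocalRing

variable {R : Type*} [CommRing R] [IsLocalRing R] {I : Type*} [Group I]

/-- **Assembly with a p-closed target.** Let `τ` be a faithful residue-trivial action of the
finite group `I` on the Noetherian local ring `R` of residue characteristic `p`, and `f : I → A` a
homomorphism to a FINITE p-CLOSED group such that `g ^ (p ^ N)` acts trivially on `𝔪/𝔪²` for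
every `g ∈ ker f`. Then `ker f` is a normal `p`-subgroup
(`BorelCore.exists_pow_eq_one_of_cotangentTrivial`) with p-closed quotient `I / ker f ≅ f(I) ≤ A`,
so `I` has a normal Sylow `p`-subgroup (`HasNormalSylow.of_isPGroup_of_quotient`). Generalises
`FlagCore.hasNormalSylow_of_character` (target without elements of order `p`). [folklore] -/
theorem hasNormalSylow_of_pClosed_quotient (p : ℕ) [Fact p.Prime] [IsNoetherianRing R]
    [CharP (ResidueField R) p] [Finite I] {τ : I →* (R ≃+* R)} (hτ : Function.Injective τ)
    (hres : ∀ (g : I) (r : R), τ g r - r ∈ maximalIdeal R)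
    {A : Type*} [Group A] [Finite A] (hA : HasNormalSylow p A) (f : I →* A) (N : ℕ)
    (hf : ∀ g, f g = 1 → ∀ r ∈ maximalIdeal R, τ (g ^ p ^ N) r - r ∈ maximalIdeal R ^ 2) :
    HasNormalSylow p I := by
  have hU : IsPGroup p f.ker := by
    rintro ⟨g, hg⟩
    obtain ⟨k, hk⟩ :=
      exists_pow_eq_one_of_cotangentTrivial p hτ hres (hf g (MonoidHom.mem_ker.mp hg))
    refine ⟨N + k, Subtype.ext ?_⟩
    rw [Subgroup.coe_pow, Subgroup.coe_one, pow_add, pow_mul]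
    exact hk
  have hQ : HasNormalSylow p (I ⧸ f.ker) :=
    (hA.subgroup f.range).of_mulEquiv (QuotientGroup.quotientKerEquivRange f).symm
  exact HasNormalSylow.of_isPGroup_of_quotient f.ker hU hQ

/-- **Inertia stabilising a flag of `𝔪/𝔪²` with p-closed graded pieces is p-closed** (Phase 0 in
arbitrary embedding dimension; crux stmt-ResolutionOfSingularities-15640, toward
`stub_phaseZeroHighDim`). Let `(R, 𝔪, κ)` be a Noetherian local ring of residue characteristic
`p`, `τ` a faithful residue-trivial action of the finite group `I` on `R`, and `K : ℕ → Ideal R`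
with `K 0 ≤ 𝔪²` and `𝔪 ≤ K n`. Suppose that for each `i < n` there is a homomorphism
`f i : I →* A i` to a FINITE p-CLOSED group whose kernel moves `K (i + 1)` only inside `K i`
(`I` acts on the piece `K (i+1) / K i` through `A i`; indices `i ≥ n` are idle). Then `I` has a
normal Sylow `p`-subgroup: `U = ker (f i)_{i<n}` lowers the flag one step, so is unipotent of
level `n` (`UnipotentLevel.iterate_sub_mem_of_flag`, `cotangentTrivial_pow_of_iterate_sub` with
`n < p ^ n`), and `I/U ↪ Π_{i<n} A i` is p-closed (`hasNormalSylow_pi`); conclude by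
`hasNormalSylow_of_pClosed_quotient`. Lines (`FlagCoreGeneral.hasNormalSylow_of_flag`) are the
pieces with `A i` a finite subgroup of `κˣ`. [folklore] -/
theorem hasNormalSylow_of_flag_pieces (p : ℕ) [Fact p.Prime] [IsNoetherianRing R]
    [CharP (ResidueField R) p] [Finite I] {τ : I →* (R ≃+* R)} (hτ : Function.Injective τ)
    (hres : ∀ (g : I) (r : R), τ g r - r ∈ maximalIdeal R)
    (n : ℕ) (K : ℕ → Ideal R) (hK0 : K 0 ≤ maximalIdeal R ^ 2) (hKn : maximalIdeal R ≤ K n)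
    {A : ℕ → Type*} [∀ i, Group (A i)] [∀ i, Finite (A i)]
    (hA : ∀ i < n, HasNormalSylow p (A i)) (f : ∀ i, I →* A i)
    (hf : ∀ i < n, ∀ g, f i g = 1 → ∀ r ∈ K (i + 1), τ g r - r ∈ K i) :
    HasNormalSylow p I := by
  have hp : p.Prime := Fact.out
  have hp_mem : (p : R) ∈ maximalIdeal R := by
    rw [← residue_eq_zero_iff, map_natCast, CharP.cast_eq_zero]
  let F : I →* (∀ i : Fin n, A i) := MonoidHom.pi fun i : Fin n => f i
  refine hasNormalSylow_of_pClosed_quotient p hτ hres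
    (hasNormalSylow_pi fun i : Fin n => hA i i.isLt) F n fun g hg => ?_
  -- `g` in the common kernel lowers the flag by one step, hence is unipotent of level `n`
  have hg1 : ∀ i : Fin n, f i g = 1 := fun i => by
    have h := congrFun hg i
    rwa [MonoidHom.pi_apply, Pi.one_apply] at h
  have hstep : ∀ i < n, ∀ r ∈ K (i + 1), τ g r - r ∈ K i :=
    fun i hi => hf i hi g (hg1 ⟨i, hi⟩)
  rw [map_pow]
  exact cotangentTrivial_pow_of_iterate_sub p (τ g) (hres g) hp_mem (n.lt_pow_self hp.one_lt).le
    fun r hr => hK0 (iterate_sub_mem_of_flag (τ g) n K hstep n 0 (by omega) r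
      (by rw [zero_add]; exact hKn hr))

end LocalRing

end Summit.ResolutionOfSingularities.ResolutionOfSingularities.Theorems.WildQuotientResolution.FlagPieces
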